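import Summits.Ventures.CertifiedManyBodySolver.Theses.TcThermcert1
import HarnessLib

/-!
# Disproof of `ThermalStiffnessCeilingU8b10_le_1o8` (K1 of route-Ventures-TcThermcert1, item stmt-Ventures-26381) — findings

Standing adversary file of hub-tc-therm-crit-1 g0 (refuter, falsifier-first). K1 is the single-temperature thermal leaf
`ObsThermalStiffnessSeqCeilingAtBeta 0 8 (7/8) 10 (1/8)`: for every ρs > 0, θ₀ > 0 and every divergent size sequence `Ls`, the finite-volume
flux premise `10·ρs·θ² ≤ log Z_{Ls j}(0) − log Z_{Ls j}(θ)` on `|θ| ≤ θ₀` forces `ρs ≤ 1/8`.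

FINDINGS (kernel-checked below unless marked «prose»):
* (a) LOAD-BEARING ANALYSIS. `0 < θ₀` is load-bearing (`k1_false_without_theta0_pos`: with θ₀ = −1 the premise is vacuous and ρs = 1
  refutes); the flux premise is load-bearing (`k1_false_without_fluxPremise`); `0 < ρs` is NOT load-bearing — K1 is equivalent to the
  variant without it (`k1_iff_without_rhoPos`), information for provers: never spend effort on the sign of ρs. The divergence hypothesis
  `Tendsto Ls atTop atTop` is load-bearing FORMALLY already by a JUNK witness (`k1_false_without_tendsto_junk`: `Ls ≡ 0` makes the
  `[NeZero (Ls j)]`-guarded premise vacuous — typists: keep divergence or size-positivity in any re-typing; same point as crit-2's K2 file),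
  and PHYSICALLY for positive sizes (a constant sequence would turn K1 into a finite-size ceiling 1/8 at EVERY even L, where finite-size flux
  curvature is enhanced) — that honest variant `K1WithoutTendstoPos` (all sizes positive) is NOT refutable in the kernel today: it needs a
  certified finite-L flux free-energy curvature at β·t = 10 exceeding 1/8 (definition only, no theorem claimed).
* (b) TIGHTNESS OF THE CONSTANT. The assembly seam is `(π/4)·c < 1/10`, i.e. `c < 4/(10π) = 0.12732…`; K1's `1/8` sits 1.8 % below it and
  K2's `9/71 = 0.126760…` sits 0.45 % below it (`seam_budget`): there is no slack to re-tune constants — a certificate must deliver c₁ ≤ 0.125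
  at the anchor. Today's hypothesis-free value is the energy-class kinematic `0.4052848` (`anchor_kinematic_today`), a factor 3.24 above.
* (c) NATURAL STRENGTHENINGS. Every strengthening of K1 (smaller c, uniform-in-U with 1/8, β-free energy class) is again a CEILING; refuting a
  ceiling needs a certified T > 0 stiffness FLOOR for 2D lattice fermions, and none exists in print or in the tree (presearch: lit-1 register
  THERMAL-LIT-LOCATORS v1.5 §A3; Mermin–Wagner / Koma–Tasaki kill pair LRO, not the helicity modulus). Hence: NO in-kernel refutation of K1 or of
  any strengthening is available; K1 is «probably true, hard» («prose», the honest verdict of two refuter seats, crit-1 and crit-2).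
* (d) TARGETS (line «trialgen_b10» of hub-tc-therm-plan-1, stubs `stub_trialGeneratorHook`, `stub_trialGeneratorCertificate_b10`): see the
  `Targets` section — no stub is refutable in the kernel; the recorded obstructions are PRICE obstructions (F4: commutator/polarisation words
  certify level-diagonal Drude-type weight `D_L`, never `Υ_L = D_L − β·Var(diag J)`; the certificate must remove ≥ 51.2 % of κ_x/2 = 0.2561;
  F7: a T = 0 cluster Drude weight is the wrong order of limits for a decision rule at fixed T).
* Traps checked and found ABSENT («prose», TRIAGE-K1K2-v3.md 7dacb5801bafd23a): gauge-periodicity vacuity (θ is the TOTAL seam flux, 2π-periodic,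
  the premise is an inequality near θ = 0 only); `Real.log` junk (Z_p > 0 in a non-empty sector); ensemble mismatch canonical ↔ KMS rows
  (closed in the tree: `IsTorusLimitOfMixture.exists_chemicalPotential_rows_of_sectorGibbs`); degenerate parameters (U → ∞ energy class 0.1629,
  odd L, filling rounding) do not bite at the anchor.

## HANDOFF
Landed under `Theorems/…/Negative/`: nothing (no negative lemma here has mathematical content beyond hypothesis bookkeeping; not proposed).
Sorried: nothing. Next regimes to try if a kit seat provides data: finite-L flux curvature at L = 4, β·t = 10 (decides `K1WithoutTendsto`);
attractive-U mirror (U < 0 is outside K1 but inside «K2 without 79/10 ≤ U» — s-wave KT phase, ceiling 9/71 at β·t = 10 physically doubtful there).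
-/

noncomputable section

namespace Summit.Ventures.CertifiedManyBodySolver.Cruxes.ThermalStiffnessCeilingU8b10_le_1o8.Disproof

open Real Filter
open Summit.Ventures.CertifiedManyBodySolver.Observables
open Summit.Ventures.CertifiedManyBodySolver.Observables.ThermalRungLeaves
open Summit.Ventures.CertifiedManyBodySolver.Theses

/-! ## (a) Load-bearing analysis -/

/-- Read-back: K1 is by definition the thermal leaf at `(t′, U, n, β, c) = (0, 8, 7/8, 10, 1/8)` (hole density `1 − 7/8`). -/
theorem k1_iff : TcThermcert1.ThermalStiffnessCeilingU8b10_le_1o8 ↔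
    (∀ (ρs θ₀ : ℝ), 0 < ρs → 0 < θ₀ → ∀ Ls : ℕ → ℕ, Tendsto Ls atTop atTop →
      (∀ (j : ℕ) [NeZero (Ls j)] (θ : ℝ), |θ| ≤ θ₀ →
        10 * ρs * θ ^ 2 ≤ thermalFluxLogZ (Ls j) 0 8 (1 - 7 / 8) 10 0 - thermalFluxLogZ (Ls j) 0 8 (1 - 7 / 8) 10 θ) →
      ρs ≤ (((1 / 8 : ℚ)) : ℝ)) := Iff.rfl

/-- K1 with the hypothesis `0 < θ₀` dropped. -/
def K1WithoutTheta0Pos : Prop :=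
  ∀ (ρs θ₀ : ℝ), 0 < ρs → ∀ Ls : ℕ → ℕ, Tendsto Ls atTop atTop →
    (∀ (j : ℕ) [NeZero (Ls j)] (θ : ℝ), |θ| ≤ θ₀ →
      10 * ρs * θ ^ 2 ≤ thermalFluxLogZ (Ls j) 0 8 (1 - 7 / 8) 10 0 - thermalFluxLogZ (Ls j) 0 8 (1 - 7 / 8) 10 θ) →
    ρs ≤ (((1 / 8 : ℚ)) : ℝ)

/-- `0 < θ₀` is load-bearing: with `θ₀ = −1` the flux premise is vacuous (no `θ` has `|θ| ≤ −1`) and `ρs = 1 > 1/8` refutes. -/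
theorem k1_false_without_theta0_pos : ¬ K1WithoutTheta0Pos := by
  intro h
  have h1 := h 1 (-1) one_pos id tendsto_id (fun j _ θ hθ => absurd hθ (by have := abs_nonneg θ; linarith))
  push_cast at h1
  norm_num at h1

/-- K1 with the flux premise dropped (only the positivity data kept). -/
def K1WithoutFluxPremise : Prop :=
  ∀ (ρs θ₀ : ℝ), 0 < ρs → 0 < θ₀ → ∀ Ls : ℕ → ℕ, Tendsto Ls atTop atTop → ρs ≤ (((1 / 8 : ℚ)) : ℝ)

/-- The flux premise is load-bearing (3c): without it `ρs = 1` refutes. -/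
theorem k1_false_without_fluxPremise : ¬ K1WithoutFluxPremise := by
  intro h
  have h1 := h 1 1 one_pos one_pos id tendsto_id
  push_cast at h1
  norm_num at h1

/-- K1 with the hypothesis `0 < ρs` dropped. -/
def K1WithoutRhoPos : Prop :=
  ∀ (ρs θ₀ : ℝ), 0 < θ₀ → ∀ Ls : ℕ → ℕ, Tendsto Ls atTop atTop →
    (∀ (j : ℕ) [NeZero (Ls j)] (θ : ℝ), |θ| ≤ θ₀ →
      10 * ρs * θ ^ 2 ≤ thermalFluxLogZ (Ls j) 0 8 (1 - 7 / 8) 10 0 - thermalFluxLogZ (Ls j) 0 8 (1 - 7 / 8) 10 θ) →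
    ρs ≤ (((1 / 8 : ℚ)) : ℝ)

/-- `0 < ρs` is NOT load-bearing: K1 is equivalent to the variant without it (for `ρs ≤ 0` the conclusion is free).
Information for provers: the sign hypothesis never needs to be used. -/
theorem k1_iff_without_rhoPos : TcThermcert1.ThermalStiffnessCeilingU8b10_le_1o8 ↔ K1WithoutRhoPos := by
  constructor
  · intro h ρs θ₀ hθ Ls hLs hprem
    by_cases hρ : 0 < ρs
    · exact h ρs θ₀ hρ hθ Ls hLs hprem
    · push_cast
      linarith
  · intro h ρs θ₀ _ hθ Ls hLs hprem
    exact h ρs θ₀ hθ Ls hLs hprem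

/-- K1 with the divergence hypothesis `Tendsto Ls atTop atTop` dropped: a FINITE-SIZE ceiling 1/8 at every size. Recorded as a definition
only — its falsity is expected (finite-size flux curvature at small even `L` is enhanced) but is not certifiable in the kernel without a
certified finite-`L` flux free energy at `β·t = 10`; no theorem is claimed. -/
def K1WithoutTendsto : Prop :=
  ∀ (ρs θ₀ : ℝ), 0 < ρs → 0 < θ₀ → ∀ Ls : ℕ → ℕ,
    (∀ (j : ℕ) [NeZero (Ls j)] (θ : ℝ), |θ| ≤ θ₀ →
      10 * ρs * θ ^ 2 ≤ thermalFluxLogZ (Ls j) 0 8 (1 - 7 / 8) 10 0 - thermalFluxLogZ (Ls j) 0 8 (1 - 7 / 8) 10 θ) →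
    ρs ≤ (((1 / 8 : ℚ)) : ℝ)

/-- The finite-size variant is formally STRONGER than K1 (so a refutation of it does not touch K1). -/
theorem k1_of_withoutTendsto (h : K1WithoutTendsto) : TcThermcert1.ThermalStiffnessCeilingU8b10_le_1o8 :=
  fun ρs θ₀ hρ hθ Ls _ hprem => h ρs θ₀ hρ hθ Ls hprem

/-- … and it is FALSE by a junk witness: the zero sequence `Ls ≡ 0` has no `NeZero (Ls j)` instance, so the guarded flux premise holds
vacuously and `ρs = 1` refutes. This says nothing about physics; it says the divergence (or a size-positivity) hypothesis must stay in the type. -/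
theorem k1_false_without_tendsto_junk : ¬ K1WithoutTendsto := by
  intro h
  have h1 := h 1 1 one_pos one_pos (fun _ => 0) (fun j inst θ _ => absurd rfl inst.out)
  push_cast at h1
  norm_num at h1

/-- The honest finite-size variant: all sizes positive, no divergence. Expected false (small even tori), not kernel-decidable today. -/
def K1WithoutTendstoPos : Prop :=
  ∀ (ρs θ₀ : ℝ), 0 < ρs → 0 < θ₀ → ∀ Ls : ℕ → ℕ, (∀ j, 0 < Ls j) →
    (∀ (j : ℕ) [NeZero (Ls j)] (θ : ℝ), |θ| ≤ θ₀ →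
      10 * ρs * θ ^ 2 ≤ thermalFluxLogZ (Ls j) 0 8 (1 - 7 / 8) 10 0 - thermalFluxLogZ (Ls j) 0 8 (1 - 7 / 8) 10 θ) →
    ρs ≤ (((1 / 8 : ℚ)) : ℝ)

/-- The junk-free variant sits between: `K1WithoutTendsto → K1WithoutTendstoPos`. -/
theorem withoutTendstoPos_of_withoutTendsto (h : K1WithoutTendsto) : K1WithoutTendstoPos :=
  fun ρs θ₀ hρ hθ Ls _ hprem => h ρs θ₀ hρ hθ Ls hprem

/-! ## (b) Tightness of the constants -/

/-- Seam budget: the assembly needs `(π/4)·c < 1/10`; `1/8` (K1) and `9/71` (K2) pass, while `0.1274 > 4/(10π) = 0.12732…` already fails —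
the constants carry < 2 % slack. -/
theorem seam_budget :
    Real.pi / 4 * (1 / 8 : ℝ) < 1 / 10 ∧ Real.pi / 4 * (9 / 71 : ℝ) < 1 / 10 ∧ ¬ (Real.pi / 4 * (0.1274 : ℝ) < 1 / 10) := by
  have hπ1 : Real.pi < 3.1416 := Real.pi_lt_d4
  have hπ2 : 3.1415 < Real.pi := Real.pi_gt_d4
  refine ⟨by nlinarith, by nlinarith, ?_⟩
  intro h
  nlinarith

/-- Today's hypothesis-free anchor value (energy class, kinematic): `c = 0.4052848` — K1 asks `1/8`, a factor `> 3.24` lower. -/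
theorem anchor_kinematic_today : ObsThermalStiffnessSeqCeilingAtBeta 0 8 (7 / 8) 10 (4052848 / 10000000) :=
  (ObsThermalStiffnessSeqCeilingAt_tp0_kinematic_decimal (U := 8) (n := 7 / 8) (by norm_num) (by norm_num)).atBeta (by norm_num)

theorem anchor_gap_ratio : (0.4052848 : ℝ) / (1 / 8) > 3.24 := by norm_num

/-- Monotonicity bookkeeping: K1 at the anchor already yields K2's box constant there (the antecedent of K2 bites only at `U = 8`). -/
theorem k2_anchor_of_k1 (h : TcThermcert1.ThermalStiffnessCeilingU8b10_le_1o8) :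
    ObsThermalStiffnessSeqCeilingAtBeta 0 8 (7 / 8) 10 (9 / 71) :=
  ObsThermalStiffnessSeqCeilingAtBeta.mono h (by norm_num)

/-! ## (c) Natural strengthenings — none refutable (see module docstring): every strengthening is a ceiling; a refutation needs a floor. -/

/-! ## (d) Targets — line «trialgen_b10» (hub-tc-therm-plan-1 g1, skeleton line-trialgen_b10.lean v2 9df8e2e8d9985737)

* `stub_trialGeneratorHook` (STUB 1; typist hubbard-thermal-p4 g0′): generalises the tree hook
  `ObsThermalStiffnessSeqCeilingAtBeta_of_torusLimit_oddMoment_le` from the Krylov member `C = i[H,J]` to an arbitrary even local generator;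
  mechanical, «probably true»; nothing to refute.
* `stub_trialGeneratorCertificate_b10` (THE certificate: for every μ₀ in the one-site band AND supporting, ∃ r a, every thermal row state has
  `Re ω(W_a(0,8)) ≤ 1/8`): not refutable in the kernel (a refutation = a row state with `Re ω(W_a) > 1/8` for EVERY admissible generator —
  i.e. a stiffness-type floor). PRICE obstructions of record (prose): F4 — commutator/polarisation words certify the level-diagonal Drude-type
  weight `κ_L/2 − Λ^off`, never `Υ_L`; the word must remove ≥ 51.2 % of `κ_x/2 = 0.2561`; F7 — a T = 0 cluster Drude weight (kit j300575) is the
  wrong order of limits for a go/no-go at fixed `T = t/10` (thermal Drude weight `D(T) → 0` expected in the TL); the binding constraint is RANGE.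
-/

end Summit.Ventures.CertifiedManyBodySolver.Cruxes.ThermalStiffnessCeilingU8b10_le_1o8.Disproof

end
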